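import Literature.Probability.Percolation.AdjSurgerySame
import Literature.Probability.Percolation.AdjSurgeryCross
import Literature.Probability.Percolation.AdjArmsFrame
import Literature.Probability.Percolation.AdjTipBoxes
import Literature.Probability.Percolation.AdjSlotDefs
import Literature.Probability.Percolation.TrapTipGuardsMid
import HarnessLib

/-!
# Surgery for the adjacent landing: the two exits of one colour from its two actual arms

Topic `Literature/Probability/Percolation`; family `crit-perc` / near-critical percolation on `𝕋`.
A brick of the near-critical arm-separation theorem for four arms in the ADJACENT colour
arrangement (P. Nolin, EJP 13 (2008), Thm. 11, `j = 4`, `σ = BBWW` [arXiv 0711.4948: Thm. 10],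
§4.4, Lemma 15 [arXiv Lemma 14]): from the two disjoint actual arms of one colour (self-avoiding
walks of `{n ≤ |v| ≤ 2M}` in the colour-read configuration `χ`, clean at `∂Λ_{2M}`, ending at middle
points of the sides `i₀`, `i₁`) and the good events of the explorations behind those sides
(`FrameGood`: both lowest-crossing explorations short and good at some scale at every term, term
tips in the middle, a closed frame about the midpoint of the side), the pair structures are BUILT
(`PairData` when `i₀ = i₁`, `CrossData` of two `PairDataB` when `i₀ ≠ i₁` — arms read by
`frameWalk`, fences of the two sides disjoint by `rot_tipBox_ne`) and the surgeries
`PairData.exists_exits` / `CrossData.exists_exits_of_rot` give **the two exits of the colour**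
(`colour_exits`) in the shape consumed by `OutMidExits4`: starts = the arm starts read in the
frames, kinds, tips (`8k`-middle), protections (`TipProt`), routes in the exit regions, tightness,
disjoint actual structures, and on a common side both exits from below with tips `17k` apart.

Everything here is proved; no named facts are introduced.

## References

* P. Nolin, Near-critical percolation in two dimensions, *Electron. J. Probab.* 13 (2008), §4.2
  Def. 6–8, §4.4 Lemma 15 and Thm. 11 (proof) (arXiv 0711.4948: Def. 6–8, Lemma 14, Thm. 10), σ = BBWW [Nolin2008].
-/

noncomputable section

open Set

namespace Literature.Probability.Percolation

open LatticeModels SimpleGraph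
open PairData (term_isCrossing term_eq tip_mem term_open term_norm_le tip_lt_of_lt)

/-- **The good event behind one side** for the configuration `χ` (already read in the frame): the
exploration of the lowest crossings from below has fewer than `T` terms and none fails rawly at all
scales, the same from above with `T'`, all term tips are `8 k_j`-middle for every scale, and a closed
frame of some scale `R` (`8 k_{K-1} ≤ R`, `2R + 1 ≤ M`) surrounds the midpoint of the side. [cite: Nolin2008, §4.4 Lemma 15 and Thm. 11 (proof) (arXiv 0711.4948: Lemma 14, Thm. 10)] -/
def FrameGood (M k₀ K T T' : ℕ) (χ : SiteConfig (Site 2)) : Prop :=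
  (trapDomain M).lowestSeq χ T = none ∧ (∀ u < T, ¬ TrapSeqFailRaw M u k₀ K χ) ∧
  (trapDomain M).flip.lowestSeq χ T' = none ∧ (∀ u < T', ¬ TrapSeqFailRawUp M u k₀ K χ) ∧
  (∀ (u : ℕ) (c : Finset (Site 2)) (z : Site 2), (trapDomain M).lowestSeq χ u = some (c, z) →
    ∀ j < K, -(2 * (M : ℤ)) + 8 * trapScale k₀ j < z 1 ∧ z 1 + 8 * trapScale k₀ j < 0) ∧
  (∀ (u : ℕ) (d : Finset (Site 2)) (z : Site 2), (trapDomain M).flip.lowestSeq χ u = some (d, z) →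
    ∀ j < K, -(2 * (M : ℤ)) + 8 * trapScale k₀ j < z 1 ∧ z 1 + 8 * trapScale k₀ j < 0) ∧
  ∃ R, 8 * trapScale k₀ (K - 1) ≤ R ∧ 2 * R + 1 ≤ M ∧ χᶜ ∈ triFrameAt (extC₃ M) R

/-- The far end of an arm ending on another side, read in this frame, is below the fence zones
(`(ρ^d (2M, t))₀ + 3k < 2M` for `d ≠ 0`, middle `t`). [folklore] -/
theorem far_end_low {M k : ℕ} {t : ℤ} (ht : -(2 * (M : ℤ)) + 8 * k < t ∧ t + 8 * k < 0) {d : ℕ} (hd : d < 6) (hd0 : d ≠ 0) :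
    (triRotIsoPow d ![2 * (M : ℤ), t]) 0 + 3 * (k : ℤ) < 2 * M := by
  obtain ⟨-, -, a0, -, b0, -, c0, -, d0, -, e0, -⟩ := rot_apply_formula (![2 * (M : ℤ), t] : Site 2)
  have e0' : (![2 * (M : ℤ), t] : Site 2) 0 = 2 * M := rfl
  have e1' : (![2 * (M : ℤ), t] : Site 2) 1 = t := rfl
  interval_cases d
  · exact absurd rfl hd0
  · rw [a0, e1']; omega
  · rw [b0, e0', e1']; omega
  · rw [c0, e0']; omega
  · rw [d0, e1']; omega
  · rw [e0, e0', e1']; omega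

/-- Sites of a frame reading lie in the annulus and are open in the frame configuration. [folklore] -/
theorem frameWalk_supp {M n i : ℕ} (hi : i ≤ 6) {χ : SiteConfig (Site 2)} {x y : Site 2} {W : triGraph.Walk x y}
    (hsupp : ∀ v ∈ W.support, (n : ℤ) ≤ triNorm v ∧ triNorm v ≤ 2 * M) (hopen : ∀ v ∈ W.support, v ∈ χ) :
    ∀ v ∈ (frameWalk i W).support, v ∈ triAnnSet n (2 * M) ∩ (rotConfig i χ : Set (Site 2)) := by
  intro v hv
  obtain ⟨u, hu, rfl⟩ := mem_support_frameWalk.1 hv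
  refine ⟨?_, ?_⟩
  · rw [mem_triAnnSet, triNorm_rot]; exact hsupp u hu
  · show triRotIsoPow (6 - i) u ∈ rotConfig i χ
    rw [mem_rotConfig, ← triRotIsoPow_add_apply, show 6 - i + i = 6 by omega, triRotIsoPow_six_apply]; exact hopen u hu

/-- A frame reading of a walk clean at `∂Λ_{2M}` is clean. [folklore] -/
theorem frameWalk_clean {M i : ℕ} {x y : Site 2} {W : triGraph.Walk x y} (hclean : ∀ v ∈ W.support, triNorm v = 2 * M → v = y) :
    ∀ v ∈ (frameWalk i W).support, triNorm v = 2 * M → v = triRotIsoPow (6 - i) y := by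
  intro v hv hvn
  obtain ⟨u, hu, rfl⟩ := mem_support_frameWalk.1 hv
  rw [triNorm_rot] at hvn
  rw [hclean u hu hvn]

/-- The frame reading of the end `ρ^i (2M, t)` is `(2M, t)`. [folklore] -/
theorem frame_end {M i : ℕ} (hi : i ≤ 6) {t : ℤ} {y : Site 2} (hy : y = triRotIsoPow i ![2 * (M : ℤ), t]) :
    triRotIsoPow (6 - i) y = ![2 * (M : ℤ), t] := by
  rw [hy, ← triRotIsoPow_add_apply, show i + (6 - i) = 6 by omega, triRotIsoPow_six_apply]

/-- The point `(2M, t)` of the side lies on `trapO M` (`-2M ≤ t ≤ 0`, `1 ≤ M`). [folklore] -/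
theorem side_point_mem_trapO {M : ℕ} (hM : 1 ≤ M) {t : ℤ} (ht : -(2 * (M : ℤ)) ≤ t ∧ t ≤ 0) :
    (![2 * (M : ℤ), t] : Site 2) ∈ trapO M := by
  have e0 : (![2 * (M : ℤ), t] : Site 2) 0 = 2 * M := rfl
  have e1 : (![2 * (M : ℤ), t] : Site 2) 1 = t := rfl
  rw [mem_trapO, mem_trapD, e0, e1]
  omega

/-- **The two exits of one colour from its two actual arms**: an exit `F` behind the side `i 0` and
an exit `F'` behind the side `i 1`, starting at the frame readings of the two arm starts (in some
order `r`), with kinds, `8k`-middle tips, protections, clean tight routes in the exit regions,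
disjoint actual structures, on a common side both from below with tips `17k` apart, and routes
meeting `∂Λ_n` only at their starts (the arms do). [cite: Nolin2008, §4.2 Def. 6–8, §4.4 Lemma 15 and Thm. 11 (proof) (arXiv 0711.4948: Def. 6–8, Lemma 14, Thm. 10), σ = BBWW] -/
theorem colour_exits {M n k₀ K T T' : ℕ} (hn : 1 ≤ n) (hnM : n ≤ M) (hk₀ : 2 ≤ k₀) (hK : 1 ≤ K)
    (hKM : ∀ j < K, 32 * trapScale k₀ j + 1 ≤ M)
    {χ : SiteConfig (Site 2)} {x y : Fin 2 → Site 2} (W : (q : Fin 2) → triGraph.Walk (x q) (y q))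
    (hpath : ∀ q, (W q).IsPath) (hnorm : ∀ q, triNorm (x q) = n)
    (hsupp : ∀ q, ∀ v ∈ (W q).support, (n : ℤ) ≤ triNorm v ∧ triNorm v ≤ 2 * M) (hopen : ∀ q, ∀ v ∈ (W q).support, v ∈ χ)
    (hclean : ∀ q, ∀ v ∈ (W q).support, triNorm v = 2 * M → v = y q) (hinner : ∀ q, ∀ v ∈ (W q).support, triNorm v = n → v = x q)
    (hdisj : ∀ v ∈ (W 0).support, v ∉ (W 1).support)
    {i : Fin 2 → ℕ} {t : Fin 2 → ℤ} (hi : ∀ q, i q < 6) (hy : ∀ q, y q = triRotIsoPow (i q) ![2 * (M : ℤ), t q])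
    (ht : ∀ q, -(2 * (M : ℤ)) + 8 * trapScale k₀ (K - 1) < t q ∧ t q + 8 * trapScale k₀ (K - 1) < 0)
    (hgood : ∀ q, FrameGood M k₀ K T T' (rotConfig (i q) χ)) :
    ∃ (r : Fin 2 → Fin 2) (F : TrapExit M n k₀ K (rotConfig (i 0) χ)) (F' : TrapExit M n k₀ K (rotConfig (i 1) χ))
      (S S' : Set (Site 2)) (up up' : Bool) (tt tt' : ℤ),
      r 0 ≠ r 1 ∧ F.a = triRotIsoPow (6 - i 0) (x (r 0)) ∧ F'.a = triRotIsoPow (6 - i 1) (x (r 1)) ∧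
      F.z 1 = (if up then tt - 3 * (F.k : ℤ) else tt) ∧ F'.z 1 = (if up' then tt' - 3 * (F'.k : ℤ) else tt') ∧
      (-(2 * (M : ℤ)) + 8 * F.k < tt ∧ tt + 8 * F.k < 0) ∧ (-(2 * (M : ℤ)) + 8 * F'.k < tt' ∧ tt' + 8 * F'.k < 0) ∧
      TipProt M up tt F.k (rotConfig (i 0) χ) ∧ TipProt M up' tt' F'.k (rotConfig (i 1) χ) ∧
      PathIn triGraph S F.a F.m ∧ PathIn triGraph S' F'.a F'.m ∧
      S ⊆ (triAnnSet n (2 * M) ∪ trapExitZone M F.z F.k) ∩ rotConfig (i 0) χ ∧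
      S' ⊆ (triAnnSet n (2 * M) ∪ trapExitZone M F'.z F'.k) ∩ rotConfig (i 1) χ ∧
      (∀ v ∈ S, 2 * (M : ℤ) < triNorm v → ExitTight F.z F.k v) ∧ (∀ v ∈ S', 2 * (M : ℤ) < triNorm v → ExitTight F'.z F'.k v) ∧
      Disjoint (triRotIsoPow (i 0) '' (S ∪ triStrip (F.z 0 + F.k) (F.z 1 + F.k) F.k F.k))
        (triRotIsoPow (i 1) '' (S' ∪ triStrip (F'.z 0 + F'.k) (F'.z 1 + F'.k) F'.k F'.k)) ∧
      (i 0 = i 1 → up = false ∧ up' = false ∧ tt ≠ tt' ∧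
        (tt < tt' → tt + 17 * F.k < tt') ∧ (tt' < tt → tt' + 17 * F'.k < tt)) ∧
      (∀ v ∈ S, triNorm v = n → v = F.a) ∧ (∀ v ∈ S', triNorm v = n → v = F'.a) := by
  have hM : 1 ≤ M := le_trans hn hnM
  -- frame sites of norm `n` of the arms are the starts
  have hstart : ∀ (f : ℕ) (q : Fin 2) (v : Site 2), v ∈ (frameWalk f (W q)).support → triNorm v = n → v = triRotIsoPow (6 - f) (x q) := by
    intro f q v hv hvn
    obtain ⟨u, hu, rfl⟩ := mem_support_frameWalk.1 hv
    rw [triNorm_rot] at hvn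
    rw [hinner q u hu hvn]
  -- terms and fences have norm `> n`
  have hterm : ∀ {v : Site 2}, v ∈ trapD M → triNorm v ≠ n := fun {v} hv hvn => by
    have h := (mem_trapD.1 hv).1
    have := le_triNorm_iff_lin.2 (Or.inl (le_refl (v 0))); omega
  have hbox : ∀ {v z : Site 2} {k : ℕ}, 1 ≤ k → 32 * k + 1 ≤ M → z 0 = 2 * (M : ℤ) →
      z 0 - (2 * k + 1) ≤ v 0 ∧ v 0 ≤ z 0 + (2 * k + 1) ∧ z 1 - (2 * k + 1) ≤ v 1 ∧ v 1 ≤ z 1 + (2 * k + 1) → triNorm v ≠ n := by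
    intro v z k hk1 hk hz hb hvn
    have := le_triNorm_iff_lin.2 (Or.inl (le_refl (v 0))); omega
  set κ := trapScale k₀ (K - 1) with hκ
  have hκ1 : 1 ≤ κ := one_le_trapScale (by omega) _
  have hκj : ∀ j < K, trapScale k₀ j ≤ κ := fun j hj => trapScale_mono k₀ (show j ≤ K - 1 by omega)
  have ht0 : ∀ q, -(2 * (M : ℤ)) ≤ t q ∧ t q ≤ 0 := fun q => by
    have := ht q; have : (0 : ℤ) ≤ κ := by positivity
    constructor <;> omega
  have hend := fun q => frame_end (M := M) (hi q).le (hy q)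
  have hyO : ∀ q, triRotIsoPow (6 - i q) (y q) ∈ trapO M := fun q => by rw [hend q]; exact side_point_mem_trapO hM (ht0 q)
  by_cases h01 : i 0 = i 1
  · -- ### the same side: a pair structure
    have eχ : rotConfig (i 0) χ = rotConfig (i 1) χ := by rw [h01]
    let D : PairData M n k₀ K T (rotConfig (i 0) χ) :=
      { a := fun q => triRotIsoPow (6 - i 0) (x q)
        y := fun q => triRotIsoPow (6 - i 0) (y q)
        A := fun q => frameWalk (i 0) (W q)
        isPath := fun q => frameWalk_isPath (hpath q)
        supp := fun q => frameWalk_supp (hi 0).le (hsupp q) (hopen q)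
        norm_a := fun q => by rw [triNorm_rot]; exact hnorm q
        y_mem := fun q => by
          fin_cases q
          · exact hyO 0
          · show triRotIsoPow (6 - i 0) (y 1) ∈ trapO M; rw [h01]; exact hyO 1
        clean := fun q => frameWalk_clean (hclean q)
        disj := frameWalk_disjoint hdisj
        stop := (hgood 0).1
        good := (hgood 0).2.1
        hn := hn
        hnM := hnM
        hk₀ := hk₀
        hKM := hKM }
    obtain ⟨u₀, u₁, c₀, c₁, z₀, z₁, hu₀, hu₁, hne, F₀, F₁, S₀, S₁, hFa₀, hFa₁, hFz₀, hFz₁, hFk₀, hFk₁, hP₀, hP₁, hS₀, hS₁, htg₀, htg₁, hdj,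
      hpr₀, hpr₁⟩ := D.exists_exits_prov
    have hdjS : Disjoint S₀ S₁ := Set.disjoint_of_subset Set.subset_union_left Set.subset_union_left hdj
    -- inner cleanness of the routes
    have inner : ∀ {S So : Set (Site 2)} {u : ℕ} {c : Finset (Site 2)} {z : Site 2} (hu : (trapDomain M).lowestSeq (rotConfig (i 0) χ) u = some (c, z))
        (q : Fin 2), S ⊆ D.Bset ∪ (D.fence hu).F → Disjoint S So → D.a (1 - q) ∈ So → ∀ v ∈ S, triNorm v = n → v = D.a q := by
      intro S So u c z hu q hS hdS ho v hv hvn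
      rcases hS hv with (⟨s, hs⟩ | ⟨u', c', z', hu', hs⟩) | hs
      · have e := hstart (i 0) s v hs hvn
        have hq : s = q ∨ s = 1 - q := by fin_cases s <;> fin_cases q <;> simp
        rcases hq with rfl | rfl
        · exact e
        · refine absurd ho (Set.disjoint_left.1 hdS ?_)
          change triRotIsoPow (6 - i 0) (x (1 - q)) ∈ S
          rw [← e]; exact hv
      · exact absurd hvn (hterm ((term_isCrossing hu').subset (Finset.mem_coe.1 hs)))
      · exact absurd hvn (hbox (D.one_le_kOf hu) (D.kOf_le hu) (mem_trapO.1 (tip_mem hu)).2 (fenceSet_box ((D.fence hu).F_subset hs)))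
    have hk₀' : F₀.k = D.kOf hu₀ := hFk₀
    have hk₁' : F₁.k = D.kOf hu₁ := hFk₁
    have hmid₀ := (hgood 0).2.2.2.2.1 u₀ c₀ z₀ hu₀ _ (D.jOf_spec hu₀).1
    have hmid₁ := (hgood 0).2.2.2.2.1 u₁ c₁ z₁ hu₁ _ (D.jOf_spec hu₁).1
    change -(2 * (M : ℤ)) + 8 * (D.kOf hu₀ : ℤ) < z₀ 1 ∧ z₀ 1 + 8 * (D.kOf hu₀ : ℤ) < 0 at hmid₀
    change -(2 * (M : ℤ)) + 8 * (D.kOf hu₁ : ℤ) < z₁ 1 ∧ z₁ 1 + 8 * (D.kOf hu₁ : ℤ) < 0 at hmid₁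
    refine ⟨id, F₀, F₁.transport eχ, S₀, S₁, false, false, z₀ 1, z₁ 1, by decide, hFa₀, ?_, by simp [hFz₀], by simp [hFz₁],
      by rw [hk₀']; exact hmid₀, by rw [TrapExit.transport_k, hk₁']; exact hmid₁, ?_, ?_, hP₀, ?_, hS₀, ?_, htg₀, ?_, ?_, fun _ => ?_,
      ?_, ?_⟩
    · rw [TrapExit.transport_a, hFa₁]; show triRotIsoPow (6 - i 0) (x 1) = triRotIsoPow (6 - i 1) (x 1); rw [h01]
    · rw [hk₀']
      exact ⟨c₀, z₀, rfl, tip_mem hu₀, term_open hu₀, fun _ => ⟨term_isCrossing hu₀, D.raw hu₀⟩, fun h => absurd h (by decide)⟩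
    · rw [TrapExit.transport_k, hk₁', ← eχ]
      exact ⟨c₁, z₁, rfl, tip_mem hu₁, term_open hu₁, fun _ => ⟨term_isCrossing hu₁, D.raw hu₁⟩, fun h => absurd h (by decide)⟩
    · rw [TrapExit.transport_a, TrapExit.transport_m]; exact hP₁
    · rw [TrapExit.transport_z, TrapExit.transport_k, ← eχ]; exact hS₁
    · rw [TrapExit.transport_z, TrapExit.transport_k]; exact htg₁
    · rw [TrapExit.transport_z, TrapExit.transport_k, ← h01]
      exact (Set.disjoint_image_iff (triRotIsoPow (i 0)).injective).2 hdj
    · refine ⟨rfl, rfl, ?_, fun hlt => ?_, fun hlt => ?_⟩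
      · intro he
        rcases Nat.lt_or_gt_of_ne hne with hl | hl
        · exact absurd he (ne_of_lt (tip_lt_of_lt hl hu₀ hu₁))
        · exact absurd he.symm (ne_of_lt (tip_lt_of_lt hl hu₁ hu₀))
      · rw [hk₀']
        rcases Nat.lt_or_gt_of_ne hne with hl | hl
        · exact D.row_gap_of_lt hl hu₀ hu₁
        · exact absurd hlt (not_lt.2 (tip_lt_of_lt hl hu₁ hu₀).le)
      · rw [TrapExit.transport_k, hk₁']
        rcases Nat.lt_or_gt_of_ne hne with hl | hl
        · exact absurd hlt (not_lt.2 (tip_lt_of_lt hl hu₀ hu₁).le)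
        · exact D.row_gap_of_lt hl hu₁ hu₀
    · rw [hFa₀]; exact inner hu₀ 0 hpr₀ hdjS (by change D.a 1 ∈ S₁; rw [← hFa₁]; exact hP₁.left_mem)
    · rw [TrapExit.transport_a, hFa₁]; exact inner hu₁ 1 hpr₁ hdjS.symm (by change D.a 0 ∈ S₀; rw [← hFa₀]; exact hP₀.left_mem)
  · -- ### two different sides: a cross structure
    -- the far ends are below every fence zone
    have hfar : ∀ q q', i q ≠ i q' → ∀ j < K, (triRotIsoPow (6 - i q) (y q')) 0 + 3 * (trapScale k₀ j : ℤ) < 2 * M := by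
      intro q q' hqq j hj
      have e : triRotIsoPow (6 - i q) (y q') = triRotIsoPow ((i q' + (6 - i q)) % 6) ![2 * (M : ℤ), t q'] := by
        rw [hy q', ← triRotIsoPow_add_apply, triRotIsoPow_mod_six_apply]
      rw [e]
      have hk := hκj j hj
      refine far_end_low (k := trapScale k₀ j) ⟨?_, ?_⟩ (Nat.mod_lt _ (by norm_num)) ?_
      · have := (ht q').1; nlinarith
      · have := (ht q').2; nlinarith
      · intro h0; have hi1 := hi q; have hi2 := hi q'; omega
    -- the structure behind the side `i q` with the arm `q` first and the arm `q'` second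
    have build : ∀ q q' : Fin 2, q ≠ q' → i q ≠ i q' → ∃ D : PairDataB M n k₀ K T T' (rotConfig (i q) χ),
        D.a 0 = triRotIsoPow (6 - i q) (x q) ∧ D.a 1 = triRotIsoPow (6 - i q) (x q') ∧
        (∀ v, v ∈ (D.A 0).support ↔ v ∈ (frameWalk (i q) (W q)).support) ∧
        (∀ v, v ∈ (D.A 1).support ↔ v ∈ (frameWalk (i q) (W q')).support) := by
      intro q q' hqq hiqq
      -- the order of the arms in this structure
      let σ : Fin 2 → Fin 2 := fun s => if s = 0 then q else q'
      have hσ0 : σ 0 = q := if_pos rfl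
      have hσ1 : σ 1 = q' := if_neg (by decide)
      have hdq : ∀ v ∈ (frameWalk (i q) (W (σ 0))).support, v ∉ (frameWalk (i q) (W (σ 1))).support := by
        rw [hσ0, hσ1]
        refine frameWalk_disjoint fun v hv hv' => ?_
        fin_cases q <;> fin_cases q'
        · exact absurd rfl hqq
        · exact hdisj v hv hv'
        · exact hdisj v hv' hv
        · exact absurd rfl hqq
      refine ⟨{ a := fun s => triRotIsoPow (6 - i q) (x (σ s))
                y := fun s => triRotIsoPow (6 - i q) (y (σ s))
                A := fun s => frameWalk (i q) (W (σ s))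
                isPath := fun s => frameWalk_isPath (hpath (σ s))
                supp := fun s => frameWalk_supp (hi q).le (hsupp (σ s)) (hopen (σ s))
                norm_a := fun s => by rw [triNorm_rot]; exact hnorm (σ s)
                y_mem := by show triRotIsoPow (6 - i q) (y (σ 0)) ∈ trapO M; rw [hσ0]; exact hyO q
                yfar := Or.inr (by show ∀ j < K, (triRotIsoPow (6 - i q) (y (σ 1))) 0 + 3 * (trapScale k₀ j : ℤ) < 2 * M
                                   rw [hσ1]; exact hfar q q' hiqq)
                clean := fun s => frameWalk_clean (hclean (σ s))
                disj := hdq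
                stop := (hgood q).1
                good := (hgood q).2.1
                hn := hn
                hnM := hnM
                hk₀ := hk₀
                hKM := hKM
                stopUp := (hgood q).2.2.1
                goodUp := (hgood q).2.2.2.1
                tip_mid := (hgood q).2.2.2.2.1
                tip_midUp := (hgood q).2.2.2.2.2.1 }, ?_, ?_, fun v => ?_, fun v => ?_⟩
      · show triRotIsoPow (6 - i q) (x (σ 0)) = _; rw [hσ0]
      · show triRotIsoPow (6 - i q) (x (σ 1)) = _; rw [hσ1]
      · show v ∈ (frameWalk (i q) (W (σ 0))).support ↔ _; rw [hσ0]
      · show v ∈ (frameWalk (i q) (W (σ 1))).support ↔ _; rw [hσ1]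
    obtain ⟨D₁, hD₁a0, hD₁a1, hD₁A0, hD₁A1⟩ := build 0 1 (by decide) h01
    obtain ⟨D₂, hD₂a0, hD₂a1, hD₂A0, hD₂A1⟩ := build 1 0 (by decide) (Ne.symm h01)
    -- the cross structure
    have hsuppW : ∀ (q : Fin 2) (f : ℕ), f ≤ 6 → ∀ v, v ∈ (frameWalk f (W q)).support ↔ triRotIsoPow f v ∈ (W q).support :=
      fun q f hf v => mem_support_frameWalk_iff hf
    have fence_far : ∀ x' y' : Site 2,
        ((∃ (u : ℕ) (c : Finset (Site 2)) (z : Site 2) (hu : (trapDomain M).lowestSeq (rotConfig (i 0) χ) u = some (c, z)), x' ∈ (D₁.fence hu).F) ∨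
          (∃ (u : ℕ) (d : Finset (Site 2)) (z : Site 2) (hu : (trapDomain M).flip.lowestSeq (rotConfig (i 0) χ) u = some (d, z)), x' ∈ (D₁.fenceUp hu).F)) →
        ((∃ (u : ℕ) (c : Finset (Site 2)) (z : Site 2) (hu : (trapDomain M).lowestSeq (rotConfig (i 1) χ) u = some (c, z)), y' ∈ (D₂.fence hu).F) ∨
          (∃ (u : ℕ) (d : Finset (Site 2)) (z : Site 2) (hu : (trapDomain M).flip.lowestSeq (rotConfig (i 1) χ) u = some (d, z)), y' ∈ (D₂.fenceUp hu).F)) →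
        triRotIsoPow (i 0) x' ≠ triRotIsoPow (i 1) y' := by
      -- every fence site lies in the box of half-width `2κ+1` about an `8κ`-middle tip of its side
      have boxOf : ∀ (q : Fin 2) (D : PairDataB M n k₀ K T T' (rotConfig (i q) χ)) (w : Site 2),
          ((∃ (u : ℕ) (c : Finset (Site 2)) (z : Site 2) (hu : (trapDomain M).lowestSeq (rotConfig (i q) χ) u = some (c, z)), w ∈ (D.fence hu).F) ∨
            (∃ (u : ℕ) (d : Finset (Site 2)) (z : Site 2) (hu : (trapDomain M).flip.lowestSeq (rotConfig (i q) χ) u = some (d, z)), w ∈ (D.fenceUp hu).F)) →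
          ∃ tq : ℤ, (-(2 * (M : ℤ)) + 8 * κ ≤ tq ∧ tq ≤ -(8 * (κ : ℤ))) ∧
            (2 * (M : ℤ) - (2 * κ + 1) ≤ w 0 ∧ w 0 ≤ 2 * M + (2 * κ + 1) ∧ tq - (2 * κ + 1) ≤ w 1 ∧ w 1 ≤ tq + (2 * κ + 1)) := by
        intro q D w hw
        rcases hw with ⟨u, c, z, hu, hw⟩ | ⟨u, d, z, hu, hw⟩
        · have hb := fenceSet_box ((D.fence hu).F_subset hw)
          have hm := D.tip_mid u c z hu (K - 1) (by omega)
          have hz := (mem_trapO.1 (tip_mem hu)).2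
          have hk : (D.kOf hu : ℤ) ≤ κ := by exact_mod_cast hκj _ (D.jOf_spec hu).1
          refine ⟨z 1, ⟨hm.1.le, by have := hm.2; omega⟩, ?_, ?_, ?_, ?_⟩ <;> omega
        · have hb := fenceSetUp_box ((D.fenceUp hu).F_subset hw)
          have hm := D.tip_midUp u d z hu (K - 1) (by omega)
          have hz := (mem_trapO.1 (tip_mem_trapO (PairDataB.termUp_isCrossing hu))).2
          have hk : (D.kOfUp hu : ℤ) ≤ κ := by exact_mod_cast hκj _ (D.jOfUp_spec hu).1
          refine ⟨z 1, ⟨hm.1.le, by have := hm.2; omega⟩, ?_, ?_, ?_, ?_⟩ <;> omega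
      intro x' y' hx hy' heq
      obtain ⟨tO, hto, hv⟩ := boxOf 0 D₁ x' hx
      obtain ⟨tC, htc, hw⟩ := boxOf 1 D₂ y' hy'
      exact rot_tipBox_ne hκ1 hto htc hv hw (hi 0) (hi 1) h01 heq
    let X : CrossData M n k₀ K T T' T T' (rotConfig (i 0) χ) (rotConfig (i 1) χ) :=
      { D₁ := D₁
        D₂ := D₂
        φ₁ := triRotIsoPow (i 0)
        φ₂ := triRotIsoPow (i 1)
        arm0 := fun v => by
          rw [hD₁A0, hsuppW 0 (i 0) (hi 0).le, hD₂A1, hsuppW 0 (i 1) (hi 1).le, RelIso.apply_symm_apply]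
        arm1 := fun v => by
          rw [hD₁A1, hsuppW 1 (i 0) (hi 0).le, hD₂A0, hsuppW 1 (i 1) (hi 1).le, RelIso.apply_symm_apply]
        start0 := by
          rw [hD₁a0, hD₂a1, ← triRotIsoPow_add_apply, show 6 - i 0 + i 0 = 6 by have := hi 0; omega, triRotIsoPow_six_apply,
            ← triRotIsoPow_add_apply, show 6 - i 1 + i 1 = 6 by have := hi 1; omega, triRotIsoPow_six_apply]
        start1 := by
          rw [hD₁a1, hD₂a0, ← triRotIsoPow_add_apply, show 6 - i 0 + i 0 = 6 by have := hi 0; omega, triRotIsoPow_six_apply,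
            ← triRotIsoPow_add_apply, show 6 - i 1 + i 1 = 6 by have := hi 1; omega, triRotIsoPow_six_apply]
        fence_far := fence_far }
    have hg₁ : X.D₁.MidGuard := by
      obtain ⟨R, hR, hRM, hg⟩ := (hgood 0).2.2.2.2.2.2
      exact D₁.midGuard_of_guard hR hRM hg
    have hg₂ : X.D₂.MidGuard := by
      obtain ⟨R, hR, hRM, hg⟩ := (hgood 1).2.2.2.2.2.2
      exact D₂.midGuard_of_guard hR hRM hg
    obtain ⟨q, F, F', S, S', up, up', tt, tt', hFa, hFa', hFz, hFz', hmid, hmid', hprot, hprot', hPF, hPF', hSF, hSF', htF, htF', hdj,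
      hpr, hpr'⟩ := X.exists_exits_of_rot_prov (hi 0) (hi 1) h01 (fun _ => rfl) (fun _ => rfl) hg₁ hg₂
    -- inner cleanness of the routes: an actual route site of norm `n` is an actual arm start
    have hDa : X.D₁.a 0 = triRotIsoPow (6 - i 0) (x 0) ∧ X.D₁.a 1 = triRotIsoPow (6 - i 0) (x 1) ∧
        X.D₂.a 0 = triRotIsoPow (6 - i 1) (x 1) ∧ X.D₂.a 1 = triRotIsoPow (6 - i 1) (x 0) := ⟨hD₁a0, hD₁a1, hD₂a0, hD₂a1⟩
    have actual : ∀ w ∈ X.B𝔅 ∪ X.FF𝔉, triNorm w = n → w = x 0 ∨ w = x 1 := by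
      intro w hw hwn
      have fence₁ : ∀ y ∈ X.D₁.FFB, triNorm y ≠ n := by
        rintro y (⟨u, c, z, hu, hy⟩ | ⟨u, d, z, hu, hy⟩)
        · exact hbox (X.D₁.one_le_kOf hu) (X.D₁.kOf_le hu) (mem_trapO.1 (tip_mem hu)).2 (fenceSet_box ((X.D₁.fence hu).F_subset hy))
        · exact hbox (X.D₁.one_le_kOfUp hu) (X.D₁.kOfUp_le hu) (mem_trapO.1 (tip_mem_trapO (PairDataB.termUp_isCrossing hu))).2
            (fenceSetUp_box ((X.D₁.fenceUp hu).F_subset hy))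
      have fence₂ : ∀ y ∈ X.D₂.FFB, triNorm y ≠ n := by
        rintro y (⟨u, c, z, hu, hy⟩ | ⟨u, d, z, hu, hy⟩)
        · exact hbox (X.D₂.one_le_kOf hu) (X.D₂.kOf_le hu) (mem_trapO.1 (tip_mem hu)).2 (fenceSet_box ((X.D₂.fence hu).F_subset hy))
        · exact hbox (X.D₂.one_le_kOfUp hu) (X.D₂.kOfUp_le hu) (mem_trapO.1 (tip_mem_trapO (PairDataB.termUp_isCrossing hu))).2
            (fenceSetUp_box ((X.D₂.fenceUp hu).F_subset hy))
      rcases hw with hw | (⟨y, hy, rfl⟩ | ⟨y, hy, rfl⟩)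
      · rcases X.mem_B𝔅 hw with ⟨y, hy, rfl⟩ | ⟨y, hy, rfl⟩
        · have hyn : triNorm y = n := by rwa [show X.φ₁ y = triRotIsoPow (i 0) y from rfl, triNorm_triRotIsoPow] at hwn
          rcases hy with ⟨s, hs⟩ | ⟨u, c, z, hu, hs⟩ | ⟨u, d, z, hu, hs⟩
          · fin_cases s
            · have e := hstart (i 0) 0 y ((hD₁A0 y).1 hs) hyn
              left; show triRotIsoPow (i 0) y = x 0
              rw [e, ← triRotIsoPow_add_apply, show 6 - i 0 + i 0 = 6 by have := hi 0; omega, triRotIsoPow_six_apply]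
            · have e := hstart (i 0) 1 y ((hD₁A1 y).1 hs) hyn
              right; show triRotIsoPow (i 0) y = x 1
              rw [e, ← triRotIsoPow_add_apply, show 6 - i 0 + i 0 = 6 by have := hi 0; omega, triRotIsoPow_six_apply]
          · exact absurd hyn (hterm ((term_isCrossing hu).subset (Finset.mem_coe.1 hs)))
          · exact absurd hyn (hterm ((PairDataB.termUp_isCrossing hu).subset (Finset.mem_coe.1 hs)))
        · have hyn : triNorm y = n := by rwa [show X.φ₂ y = triRotIsoPow (i 1) y from rfl, triNorm_triRotIsoPow] at hwn
          rcases hy with ⟨s, hs⟩ | ⟨u, c, z, hu, hs⟩ | ⟨u, d, z, hu, hs⟩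
          · fin_cases s
            · have e := hstart (i 1) 1 y ((hD₂A0 y).1 hs) hyn
              right; show triRotIsoPow (i 1) y = x 1
              rw [e, ← triRotIsoPow_add_apply, show 6 - i 1 + i 1 = 6 by have := hi 1; omega, triRotIsoPow_six_apply]
            · have e := hstart (i 1) 0 y ((hD₂A1 y).1 hs) hyn
              left; show triRotIsoPow (i 1) y = x 0
              rw [e, ← triRotIsoPow_add_apply, show 6 - i 1 + i 1 = 6 by have := hi 1; omega, triRotIsoPow_six_apply]
          · exact absurd hyn (hterm ((term_isCrossing hu).subset (Finset.mem_coe.1 hs)))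
          · exact absurd hyn (hterm ((PairDataB.termUp_isCrossing hu).subset (Finset.mem_coe.1 hs)))
      · exact absurd (by rwa [show X.φ₁ y = triRotIsoPow (i 0) y from rfl, triNorm_triRotIsoPow] at hwn) (fence₁ y hy)
      · exact absurd (by rwa [show X.φ₂ y = triRotIsoPow (i 1) y from rfl, triNorm_triRotIsoPow] at hwn) (fence₂ y hy)
    -- the two actual starts of the routes
    have e1 : X.D₁.a q = triRotIsoPow (6 - i 0) (x q) := by
      fin_cases q
      · exact hD₁a0
      · exact hD₁a1
    have e2 : X.D₂.a q = triRotIsoPow (6 - i 1) (x (1 - q)) := by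
      fin_cases q
      · exact hD₂a0
      · exact hD₂a1
    have hsa : triRotIsoPow (i 0) F.a = x q ∧ triRotIsoPow (i 1) F'.a = x (1 - q) := by
      rw [hFa, hFa', e1, e2, ← triRotIsoPow_add_apply, show 6 - i 0 + i 0 = 6 by have := hi 0; omega, triRotIsoPow_six_apply,
        ← triRotIsoPow_add_apply, show 6 - i 1 + i 1 = 6 by have := hi 1; omega, triRotIsoPow_six_apply]
      exact ⟨rfl, rfl⟩
    have hdjS : Disjoint (triRotIsoPow (i 0) '' S) (triRotIsoPow (i 1) '' S') :=
      Set.disjoint_of_subset (Set.image_mono Set.subset_union_left) (Set.image_mono Set.subset_union_left) hdj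
    have hx01 : x 0 ≠ x 1 := fun e => hdisj (x 0) (W 0).start_mem_support (by rw [e]; exact (W 1).start_mem_support)
    have inner₁ : ∀ v ∈ S, triNorm v = n → v = F.a := by
      intro v hv hvn
      have hw : triRotIsoPow (i 0) v ∈ X.B𝔅 ∪ X.FF𝔉 := hpr ⟨v, hv, rfl⟩
      apply (triRotIsoPow (i 0)).injective
      rw [hsa.1]
      rcases actual _ hw (by rw [triNorm_triRotIsoPow, hvn]) with e | e <;> fin_cases q
      · exact e
      · exfalso; refine Set.disjoint_left.1 hdjS ⟨v, hv, rfl⟩ ⟨F'.a, hPF'.left_mem, ?_⟩; rw [hsa.2, e]; rfl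
      · exfalso; refine Set.disjoint_left.1 hdjS ⟨v, hv, rfl⟩ ⟨F'.a, hPF'.left_mem, ?_⟩; rw [hsa.2, e]; rfl
      · exact e
    have inner₂ : ∀ v ∈ S', triNorm v = n → v = F'.a := by
      intro v hv hvn
      have hw : triRotIsoPow (i 1) v ∈ X.B𝔅 ∪ X.FF𝔉 := hpr' ⟨v, hv, rfl⟩
      apply (triRotIsoPow (i 1)).injective
      rw [hsa.2]
      rcases actual _ hw (by rw [triNorm_triRotIsoPow, hvn]) with e | e <;> fin_cases q
      · exfalso; refine Set.disjoint_left.1 hdjS ⟨F.a, hPF.left_mem, ?_⟩ ⟨v, hv, rfl⟩; rw [hsa.1, e]; rfl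
      · exact e
      · exact e
      · exfalso; refine Set.disjoint_left.1 hdjS ⟨F.a, hPF.left_mem, ?_⟩ ⟨v, hv, rfl⟩; rw [hsa.1, e]; rfl
    refine ⟨fun s => if s = 0 then q else 1 - q, F, F', S, S', up, up', tt, tt', ?_, ?_, ?_, hFz, hFz', hmid, hmid', hprot, hprot',
      hPF, hPF', hSF, hSF', htF, htF', hdj, fun h => absurd h h01, inner₁, inner₂⟩
    · fin_cases q <;> decide
    · rw [hFa]; show X.D₁.a q = _; simp only [if_true]
      fin_cases q
      · exact hD₁a0
      · exact hD₁a1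
    · rw [hFa']; show X.D₂.a q = _; simp only [show (1 : Fin 2) ≠ 0 by decide, if_false]
      fin_cases q
      · exact hD₂a0
      · exact hD₂a1

end Literature.Probability.Percolation
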